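import Summits.CriticalPhenomena.Ising3D.TaylorRegionDeltaLitOddP
import Summits.CriticalPhenomena.Ising3D.TaylorRegionDeltaLitCapstone
import Mathlib.Tactic.Linarith
import Mathlib.Tactic.Positivity
import Mathlib.Tactic.Ring
import HarnessLib

/-!
# The odd cone over a wide box from literal tables with CHEAP pieces (`oddCone_of_splitΔLP`)
(cell `pub-ising3x`, seat recog-1 gen 14; gate (g1)/(g2) — assembly theorem for `TaylorRegionDeltaLitOddP`)

HONEST FRAMING: lottery ticket; floor = tightest certified 3D Ising CFT bounds; no exact-solution
claim without a proof. Island framing: certified exclusion region at stated derivative order and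
assumptions; not a determination of the 3D Ising critical exponents beyond that.

The landed assembly proof of `oddCone_of_splitΔL` (TaylorRegionDeltaLitOdd) with the piece step swapped for the cheap
pieces `OddConeRegionDataΔ.pieceOKBP` (piece-level remainder bounds + inner bisection, soundness `posOnOddP_sound`):
atoms, sizes, literal `(P, D)` / `(E, θ)` tail tables, tail legs per θ-cell, δ-table containments and row containments
are unchanged; plus the `TaylorTable` glue `TaylorTable.oddCone_of_splitΔLP` and the all-cheap capstone
`TaylorTable.boxExcluded_of_taylorTable_dec_of_splitΔLPP` (even `…ΔLP` + odd `…ΔLP`). Elementary. [folklore]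
-/

namespace Summit.CriticalPhenomena.Ising3D

open Finset Set
open Literature.Analysis.ValidatedNumerics Literature.Analysis.ValidatedNumerics.PolyMP
open Literature.Analysis.ValidatedNumerics.NumericsMP (MI)
open Literature.MathematicalPhysics.QuantumFieldTheory.ConformalBootstrap3D

set_option maxHeartbeats 400000 in
/-- **The odd cone over a wide box from literal tables, cheap pieces** (piece-level remainder bounds, inner bisection;
the landed proof of `oddCone_of_splitΔL` with the piece step swapped). [folklore] -/
theorem oddCone_of_splitΔLP (d : OddConeRegionDataΔ) (LP LT : IPoly2x5) (TT : ITab3x5) (L : List OddLit)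
    (B : List (List ℚ)) (hl : d.l.Nodup) (hlψ : d.lψ.Nodup) (ha : d.toCertH.atomsOK = true) (hs : d.sizesOK = true)
    (hprm : d.tailPrmOK = true) (hlen : d.tailLenOK LT = true)
    (hPD : ∀ c : ℕ, c < 5 → d.pdLitOK LP c = true)
    (hmom : ∀ c r : ℕ, c < 5 → r < d.R → d.momRowLitOK LP LT c r = true)
    (hcell : ∀ leg k : ℕ, leg < 4 → k < (d.legPrm leg).nθ → d.tailCellOK LT leg k = true)
    (hT : ∀ c m : ℕ, c < 5 → m < 3 → d.tabOKc TT c m = true)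
    (hr : ∀ j : ℕ, j < d.J1 + 1 → d.rowLitOKL TT L j = true)
    (hpc : ∀ j k : ℕ, j < d.J1 + 1 → k < numPieces B j → d.pieceOKBP L B j k = true) :
    ∀ p ∈ Icc (d.σlo : ℝ) d.σhi ×ˢ Icc (d.εlo : ℝ) d.εhi, ∀ (E : ℝ) (j : ℕ), ((d.E0 : ℚ) : ℝ) ≤ E → (j : ℝ) ≤ E →
      OddConeAt (taylorCrossing (1 / 2) (1 / 2) d.l.toFinset fun i ab => (d.cQ i ab : ℝ))
        (∑ ab ∈ d.lψ.toFinset, (d.ψQ ab : ℝ) • taylorCoeffAt (1 / 2) (1 / 2) ab) (d.κ₀Q : ℝ) p.1 p.2 E j := by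
  simp only [OddConeRegionDataΔ.sizesOK, OddConeRegionDataH.sizesOK, Bool.and_eq_true, decide_eq_true_eq] at hs
  obtain ⟨⟨⟨⟨⟨⟨⟨hsz, hσ⟩, hε⟩, hZ3⟩, hZ4⟩, hZ5⟩, hZψ0⟩, hZψt⟩ := hs
  obtain ⟨⟨⟨⟨⟨⟨⟨⟨hS, hκ₀⟩, hE0⟩, hJ1⟩, hN3⟩, hN4⟩, hN5⟩, hNψ0⟩, hNψt⟩ := hsz
  have hS : 0 < d.S := hS
  have hκ₀ : 0 < d.κ₀Q := hκ₀
  have hE0 : 0 < d.E0 := hE0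
  have hJ1 : d.E1 ≤ (d.J1 : ℚ) + 1 := hJ1
  have hN3 : kernelSizeOK d.S (d.cQ 2) (-1) (enclQ d.S ((d.σlo + d.εlo) / 2) ((d.σhi + d.εhi) / 2)) d.ccT d.l d.N =
      true := hN3
  have hN4 : kernelSizeOK d.S (d.cQ 3) (-1) (enclQ d.S d.σlo d.σhi) d.ccT d.l d.N = true := hN4
  have hN5 : kernelSizeOK d.S (d.cQ 4) 1 (enclQ d.S d.σlo d.σhi) d.ccT d.l d.N = true := hN5
  have hNψ0 : kernelSizeOK d.S d.ψQ 0 (MI.ofInt d.S 0) d.ccT d.lψ d.N = true := hNψ0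
  have hNψt : kernelSizeOK d.S d.ψQ 0 (enclQ d.S (d.σlo - d.εhi) (d.σhi - d.εlo)) d.ccT d.lψ d.N = true := hNψt
  simp only [OddConeRegionDataΔ.tailPrmOK, Bool.and_eq_true, decide_eq_true_eq] at hprm
  obtain ⟨⟨⟨⟨⟨⟨⟨⟨hR, hθ1⟩, hθ2⟩, hθ3⟩, hθ4⟩, hn1⟩, hn2⟩, hn3⟩, hn4⟩ := hprm
  simp only [OddConeRegionDataΔ.tailLenOK, Bool.and_eq_true, decide_eq_true_eq] at hlen
  obtain ⟨⟨⟨⟨l3, l4⟩, l5⟩, lψ0⟩, lψt⟩ := hlen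
  simp only [OddConeRegionCertH.atomsOK, Bool.and_eq_true, decide_eq_true_eq] at ha
  obtain ⟨⟨⟨⟨⟨⟨⟨⟨_, _⟩, _⟩, hk1lo⟩, hk1hi⟩, hk2lo⟩, hk2hi⟩, hk3lo⟩, hk3hi⟩ := ha
  have hk1lo : d.k1lo.ok d.S 1 2 (d.σlo + d.εlo) = true := hk1lo
  have hk1hi : d.k1hi.ok d.S 1 2 (d.σhi + d.εhi) = true := hk1hi
  have hk2lo : d.k2lo.ok d.S 1 2 (d.εlo - d.σhi) = true := hk2lo
  have hk2hi : d.k2hi.ok d.S 1 2 (d.εhi - d.σlo) = true := hk2hi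
  have hk3lo : d.k3lo.ok d.S 2 1 (2 * d.εlo) = true := hk3lo
  have hk3hi : d.k3hi.ok d.S 2 1 (2 * d.εhi) = true := hk3hi
  -- the split containments, component by component (definitional unfolding of `proj5` / `comp*`)
  have pd3 : subset2I (kernelPDLI d.S (d.cQ 2) (-1)
      (signedChooseI d.S (enclQ d.S ((d.σlo + d.εlo) / 2) ((d.σhi + d.εhi) / 2))) d.ccT d.l) LP.1 = true :=
    hPD 0 (by norm_num)
  have pd4 : subset2I (kernelPDLI d.S (d.cQ 3) (-1) (signedChooseI d.S (enclQ d.S d.σlo d.σhi)) d.ccT d.l) LP.2.1 =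
      true := hPD 1 (by norm_num)
  have pd5 : subset2I (kernelPDLI d.S (d.cQ 4) 1 (signedChooseI d.S (enclQ d.S d.σlo d.σhi)) d.ccT d.l) LP.2.2.1 =
      true := hPD 2 (by norm_num)
  have pdψ0 : subset2I (kernelPDLI d.S d.ψQ 0 (signedChooseI d.S (MI.ofInt d.S 0)) d.ccT d.lψ) LP.2.2.2.1 = true :=
    hPD 3 (by norm_num)
  have pdψt : subset2I (kernelPDLI d.S d.ψQ 0 (signedChooseI d.S (enclQ d.S (d.σlo - d.εhi) (d.σhi - d.εlo))) d.ccT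
      d.lψ) LP.2.2.2.2 = true := hPD 4 (by norm_num)
  have mr3 : ∀ r : ℕ, r < d.R → subsetI (substMomRowI d.S LP.1 d.ccT d.N r) (LT.1.getD r []) = true :=
    fun r hr => hmom 0 r (by norm_num) hr
  have mr4 : ∀ r : ℕ, r < d.R → subsetI (substMomRowI d.S LP.2.1 d.ccT d.N r) (LT.2.1.getD r []) = true :=
    fun r hr => hmom 1 r (by norm_num) hr
  have mr5 : ∀ r : ℕ, r < d.R → subsetI (substMomRowI d.S LP.2.2.1 d.ccT d.N r) (LT.2.2.1.getD r []) = true :=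
    fun r hr => hmom 2 r (by norm_num) hr
  have mrψ0 : ∀ r : ℕ, r < d.R → subsetI (substMomRowI d.S LP.2.2.2.1 d.ccT d.N r) (LT.2.2.2.1.getD r []) = true :=
    fun r hr => hmom 3 r (by norm_num) hr
  have mrψt : ∀ r : ℕ, r < d.R → subsetI (substMomRowI d.S LP.2.2.2.2 d.ccT d.N r) (LT.2.2.2.2.getD r []) = true :=
    fun r hr => hmom 4 r (by norm_num) hr
  have t3 : ∀ m : ℕ, m < 3 → tabOK d.S (d.cQ 2) (-1) d.b0 d.Wb d.ccQ d.l TT.1 m = true :=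
    fun m hm => hT 0 m (by norm_num) hm
  have t4 : ∀ m : ℕ, m < 3 → tabOK d.S (d.cQ 3) (-1) d.σ0 d.Wσ d.ccQ d.l TT.2.1 m = true :=
    fun m hm => hT 1 m (by norm_num) hm
  have t5 : ∀ m : ℕ, m < 3 → tabOK d.S (d.cQ 4) 1 d.σ0 d.Wσ d.ccQ d.l TT.2.2.1 m = true :=
    fun m hm => hT 2 m (by norm_num) hm
  have tψ0 : ∀ m : ℕ, m < 3 → tabOK d.S d.ψQ 0 0 0 d.ccQ d.lψ TT.2.2.2.1 m = true :=
    fun m hm => hT 3 m (by norm_num) hm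
  have tψt : ∀ m : ℕ, m < 3 → tabOK d.S d.ψQ 0 d.t0 d.Wt d.ccQ d.lψ TT.2.2.2.2 m = true :=
    fun m hm => hT 4 m (by norm_num) hm
  have hM1 : halfStripPos2 d.S (d.TML LT 1) (d.E1 - d.ccT) d.prmM1 = true :=
    halfStripPos2_of_hsCells (lt_of_lt_of_le zero_lt_one hθ1) hn1 fun k hk => hcell 0 k (by norm_num) hk
  have hM2 : halfStripPos2 d.S (d.TML LT (-1)) (d.E1 - d.ccT) d.prmM2 = true :=
    halfStripPos2_of_hsCells (lt_of_lt_of_le zero_lt_one hθ2) hn2 fun k hk => hcell 1 k (by norm_num) hk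
  have hR1 : halfStripPos2 d.S (d.TRL LT 1) (d.E1 - d.ccT) d.prmR1 = true :=
    halfStripPos2_of_hsCells (lt_of_lt_of_le zero_lt_one hθ3) hn3 fun k hk => hcell 2 k (by norm_num) hk
  have hR2 : halfStripPos2 d.S (d.TRL LT (-1)) (d.E1 - d.ccT) d.prmR2 = true :=
    halfStripPos2_of_hsCells (lt_of_lt_of_le zero_lt_one hθ4) hn4 fun k hk => hcell 3 k (by norm_num) hk
  have hWσ : 0 ≤ d.Wσ := by unfold OddConeRegionDataΔ.Wσ; linarith
  have hWε : 0 ≤ d.Wε := by unfold OddConeRegionDataΔ.Wε; linarith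
  have hWb : 0 ≤ d.Wb := by unfold OddConeRegionDataΔ.Wb; linarith
  have hWt : 0 ≤ d.Wt := by unfold OddConeRegionDataΔ.Wt; linarith
  intro p hp E j hE hj
  obtain ⟨h1, h2, h3, h4⟩ : (d.σlo : ℝ) ≤ p.1 ∧ p.1 ≤ d.σhi ∧ (d.εlo : ℝ) ≤ p.2 ∧ p.2 ≤ d.εhi := by
    simp only [Set.mem_prod, Set.mem_Icc] at hp; exact ⟨hp.1.1, hp.1.2, hp.2.1, hp.2.2⟩
  -- the box scalars via root atoms
  have hK1 : MI.mem d.S ((1 / 2 : ℝ) ^ (p.1 + p.2)) d.K1 :=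
    mem_half_rpow_span hS hk1lo hk1hi (by push_cast; linarith) (by push_cast; linarith)
  have hK2 : MI.mem d.S ((1 / 2 : ℝ) ^ (p.2 - p.1)) d.K2 :=
    mem_half_rpow_span hS hk2lo hk2hi (by push_cast; linarith) (by push_cast; linarith)
  have hK3 : MI.mem d.S ((1 / 2 : ℝ) ^ (-(2 * p.2))) d.K3 :=
    mem_half_rpow_neg_span hS hk3lo hk3hi (y := 2 * p.2) (by push_cast; linarith) (by push_cast; linarith)
  have hEpos : 0 < E := lt_of_lt_of_le (by exact_mod_cast hE0) hE
  by_cases hE1 : ((d.E1 : ℚ) : ℝ) ≤ E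
  · -- TAIL: the exact (E, θ) argument of `oddCone_of_oddConeRegionCheckEJ` on the LITERAL tables
    have hsσ : MI.mem d.S p.1 (enclQ d.S d.σlo d.σhi) := mem_enclQ _ h1 h2
    have hsb : MI.mem d.S ((p.1 + p.2) / 2) (enclQ d.S ((d.σlo + d.εlo) / 2) ((d.σhi + d.εhi) / 2)) :=
      mem_enclQ _ (by push_cast; linarith) (by push_cast; linarith)
    have hst : MI.mem d.S (p.1 - p.2) (enclQ d.S (d.σlo - d.εhi) (d.σhi - d.εlo)) :=
      mem_enclQ _ (by push_cast; linarith) (by push_cast; linarith)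
    have h0mem : MI.mem d.S (0 : ℝ) (MI.ofInt d.S 0) := by simpa using MI.mem_ofInt d.S 0
    have hθ := div_mem_unit hEpos hj
    have hP : ((d.E1 - d.ccT : ℚ) : ℝ) ≤ E - d.ccT := by push_cast; linarith
    have e3 := qSum_eq_eval2_momTable hS (d.cQ 2) (-1) hsb d.ccT hl hN3 hR hEpos j
    have e4 := qSum_eq_eval2_momTable hS (d.cQ 3) (-1) hsσ d.ccT hl hN4 hR hEpos j
    have e5 := qSum_eq_eval2_momTable hS (d.cQ 4) 1 hsσ d.ccT hl hN5 hR hEpos j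
    have eψ0 := qSum_eq_eval2_momTable hS d.ψQ 0 h0mem d.ccT hlψ hNψ0 hR hEpos j
    have eψt := qSum_eq_eval2_momTable hS d.ψQ 0 hst d.ccT hlψ hNψt hR hEpos j
    have p3 : PMem2 d.S (momTable (d.cQ 2) (-1) ((p.1 + p.2) / 2) d.ccT d.l d.N d.R) LT.1 :=
      pmem2_substMom_of_rows hS (pmem2_of_subset2I (pmem2_kernelPDLI_of_mem hS hsb (d.cQ 2) (-1) d.ccT d.l) pd3)
        d.ccT d.N d.R l3 mr3
    have p4 : PMem2 d.S (momTable (d.cQ 3) (-1) p.1 d.ccT d.l d.N d.R) LT.2.1 :=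
      pmem2_substMom_of_rows hS (pmem2_of_subset2I (pmem2_kernelPDLI_of_mem hS hsσ (d.cQ 3) (-1) d.ccT d.l) pd4)
        d.ccT d.N d.R l4 mr4
    have p5 : PMem2 d.S (momTable (d.cQ 4) 1 p.1 d.ccT d.l d.N d.R) LT.2.2.1 :=
      pmem2_substMom_of_rows hS (pmem2_of_subset2I (pmem2_kernelPDLI_of_mem hS hsσ (d.cQ 4) 1 d.ccT d.l) pd5)
        d.ccT d.N d.R l5 mr5
    have pψ0 : PMem2 d.S (momTable d.ψQ 0 0 d.ccT d.lψ d.N d.R) LT.2.2.2.1 :=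
      pmem2_substMom_of_rows hS (pmem2_of_subset2I (pmem2_kernelPDLI_of_mem hS h0mem d.ψQ 0 d.ccT d.lψ) pdψ0)
        d.ccT d.N d.R lψ0 mrψ0
    have pψt : PMem2 d.S (momTable d.ψQ 0 (p.1 - p.2) d.ccT d.lψ d.N d.R) LT.2.2.2.2 :=
      pmem2_substMom_of_rows hS (pmem2_of_subset2I (pmem2_kernelPDLI_of_mem hS hst d.ψQ 0 d.ccT d.lψ) pdψt)
        d.ccT d.N d.R lψt mrψt
    have pM : ∀ ε : ℤ, PMem2 d.S (add2 (momTable d.ψQ 0 0 d.ccT d.lψ d.N d.R)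
        (smul2 (-(ε : ℝ)) (smul2 ((1 / 2 : ℝ) ^ (p.1 + p.2))
          (momTable (d.cQ 2) (-1) ((p.1 + p.2) / 2) d.ccT d.l d.N d.R)))) (d.TML LT ε) := fun ε =>
      pmem2_add2I pψ0 (pmem2_smul2QI _ (by push_cast; ring) (pmem2_smul2MI hS hK1 p3))
    have pR : ∀ ε : ℤ, PMem2 d.S
        (add2 (add2 (momTable (d.cQ 3) (-1) p.1 d.ccT d.l d.N d.R)
            (smul2 (-1) (momTable (d.cQ 4) 1 p.1 d.ccT d.l d.N d.R)))
          (add2 (smul2 (-(ε : ℝ) * ((d.κ₀Q : ℝ) / 2))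
              (smul2 ((1 / 2 : ℝ) ^ (p.2 - p.1)) (momTable (d.cQ 2) (-1) ((p.1 + p.2) / 2) d.ccT d.l d.N d.R)))
            (smul2 (-((d.κ₀Q : ℝ)⁻¹ / 2))
              (smul2 ((1 / 2 : ℝ) ^ (-(2 * p.2))) (momTable d.ψQ 0 (p.1 - p.2) d.ccT d.lψ d.N d.R)))))
        (d.TRL LT ε) := fun ε =>
      pmem2_add2I (pmem2_add2I p4 (pmem2_neg2I p5))
        (pmem2_add2I (pmem2_smul2QI _ (by push_cast; ring) (pmem2_smul2MI hS hK2 p3))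
          (pmem2_smul2QI _ (by push_cast; ring) (pmem2_smul2MI hS hK3 pψt)))
    have vM1 := halfStripPos2_sound hS (pM 1) hM1 hP hθ.1 (hθ.2.trans (by exact_mod_cast hθ1))
    have vM2 := halfStripPos2_sound hS (pM (-1)) hM2 hP hθ.1 (hθ.2.trans (by exact_mod_cast hθ2))
    have vR1 := halfStripPos2_sound hS (pR 1) hR1 hP hθ.1 (hθ.2.trans (by exact_mod_cast hθ3))
    have vR2 := halfStripPos2_sound hS (pR (-1)) hR2 hP hθ.1 (hθ.2.trans (by exact_mod_cast hθ4))
    simp only [eval2_add2, eval2_smul2, Int.cast_one, Int.cast_neg] at vM1 vM2 vR1 vR2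
    simp only [Rat.cast_neg, Rat.cast_one, Rat.cast_zero] at e3 e4 e5 eψ0 eψt
    rw [← e3, ← eψ0] at vM1 vM2
    rw [← e3, ← e4, ← e5, ← eψt] at vR1 vR2
    have hκ₁ : 0 ≤ (1 / 2 : ℝ) ^ (p.1 + p.2) := (Real.rpow_pos_of_pos (by norm_num) _).le
    have hκ₂ : 0 ≤ (1 / 2 : ℝ) ^ (p.2 - p.1) := (Real.rpow_pos_of_pos (by norm_num) _).le
    have hκ₀R : (0 : ℝ) < (d.κ₀Q : ℝ) := by exact_mod_cast hκ₀
    refine oddConeAt_half_of_qCone _ _ _ _ _ p.1 p.2 E j hj ?_ ?_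
    · rw [← abs_of_nonneg hκ₁, ← abs_mul, abs_le]
      constructor <;> linarith
    · have hc : 0 ≤ (d.κ₀Q : ℝ) / 2 * (1 / 2 : ℝ) ^ (p.2 - p.1) := by positivity
      rcases le_total 0 (qSum (fun ab => (d.cQ 2 ab : ℝ)) d.l.toFinset ((p.1 + p.2) / 2) (-1) E j) with h3 | h3
      · rw [abs_of_nonneg h3]; linarith
      · rw [abs_of_nonpos h3]
        have := mul_nonneg hc (neg_nonneg.mpr h3)
        nlinarith
  · -- BOUNDED PART: δ-expanded row triples from the literal tables, producer breakpoints
    have hElt : E < d.E1 := lt_of_not_ge hE1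
    have hjJ : j < d.J1 + 1 := by
      have h1' : (j : ℝ) < (d.J1 : ℝ) + 1 := by
        have : ((d.E1 : ℚ) : ℝ) ≤ (d.J1 : ℝ) + 1 := by exact_mod_cast hJ1
        linarith
      exact_mod_cast h1'
    -- the δ's
    have hδσ : |p.1 - d.σ0| ≤ d.Wσ := by
      unfold OddConeRegionDataΔ.σ0 OddConeRegionDataΔ.Wσ; push_cast; rw [abs_le]; constructor <;> linarith
    have hδb : |(p.1 + p.2) / 2 - d.b0| ≤ d.Wb := by
      unfold OddConeRegionDataΔ.b0 OddConeRegionDataΔ.Wb OddConeRegionDataΔ.σ0 OddConeRegionDataΔ.Wσ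
        OddConeRegionDataΔ.ε0 OddConeRegionDataΔ.Wε
      push_cast; rw [abs_le]; constructor <;> linarith
    have hδt : |(p.1 - p.2) - d.t0| ≤ d.Wt := by
      unfold OddConeRegionDataΔ.t0 OddConeRegionDataΔ.Wt OddConeRegionDataΔ.σ0 OddConeRegionDataΔ.Wσ
        OddConeRegionDataΔ.ε0 OddConeRegionDataΔ.Wε
      push_cast; rw [abs_le]; constructor <;> linarith
    have hδ0 : |(0 : ℝ)| ≤ ((0 : ℚ) : ℝ) := by simp
    -- q-sums as triples
    have e3 := qSum_eq_delta_rows hS (d.cQ 2) (-1) d.b0 hWb d.ccQ hl hZ3 hδb E j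
    have e4 := qSum_eq_delta_rows hS (d.cQ 3) (-1) d.σ0 hWσ d.ccQ hl hZ4 hδσ E j
    have e5 := qSum_eq_delta_rows hS (d.cQ 4) 1 d.σ0 hWσ d.ccQ hl hZ5 hδσ E j
    have eψ0 := qSum_eq_delta_rows hS d.ψQ 0 0 le_rfl d.ccQ hlψ hZψ0 hδ0 E j
    have eψt := qSum_eq_delta_rows hS d.ψQ 0 d.t0 hWt d.ccQ hlψ hZψt hδt E j
    have ab : ((d.b0 : ℚ) : ℝ) + ((p.1 + p.2) / 2 - d.b0) = (p.1 + p.2) / 2 := by ring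
    have aσ : ((d.σ0 : ℚ) : ℝ) + (p.1 - d.σ0) = p.1 := by ring
    have a0 : (((0 : ℚ) : ℚ) : ℝ) + (0 : ℝ) = 0 := by simp
    have at' : ((d.t0 : ℚ) : ℝ) + ((p.1 - p.2) - d.t0) = p.1 - p.2 := by ring
    rw [ab] at e3; rw [aσ] at e4 e5; rw [a0] at eψ0; rw [at'] at eψt
    simp only [Rat.cast_neg, Rat.cast_one, Rat.cast_zero] at e3 e4 e5 eψ0 eψt
    -- memberships in the triples from the literal tables, then in the literal rows
    have q3 := pmem3_tripL hS (d.cQ 2) (-1) d.b0 hWb d.ccQ d.l t3 d.N j hδb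
    have q4 := pmem3_tripL hS (d.cQ 3) (-1) d.σ0 hWσ d.ccQ d.l t4 d.N j hδσ
    have q5 := pmem3_tripL hS (d.cQ 4) 1 d.σ0 hWσ d.ccQ d.l t5 d.N j hδσ
    have qψ0 := pmem3_tripL hS d.ψQ 0 0 le_rfl d.ccQ d.lψ tψ0 d.N j hδ0
    have qψt := pmem3_tripL hS d.ψQ 0 d.t0 hWt d.ccQ d.lψ tψt d.N j hδt
    have hrow := hr j hjJ
    simp only [OddConeRegionDataΔ.rowLitOKL, OddConeRegionDataΔ.rowLitRowOK, Bool.and_eq_true] at hrow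
    obtain ⟨⟨⟨⟨s3, s4⟩, s5⟩, sψ0⟩, sψt⟩ := hrow
    have m3 := pmem3_of_subset3 q3 s3
    have m4 := pmem3_of_subset3 q4 s4
    have m5 := pmem3_of_subset3 q5 s5
    have mψ0 := pmem3_of_subset3 qψ0 sψ0
    have mψt := pmem3_of_subset3 qψt sψt
    -- locate the piece among the producer breakpoints
    have hmE2 : max (d.E0 : ℝ) (j : ℝ) ≤ E := max_le hE hj
    set K : ℕ := numPieces B j with hKdef
    have hK : 0 < K := numPieces_pos B j
    have e0 : d.bp B j 0 = max d.E0 (j : ℚ) - d.ccQ := by simp [OddConeRegionDataΔ.bp, OddConeRegionDataΔ.bpRow]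
    have eK : d.bp B j K = d.E1 - d.ccQ := by
      simp [OddConeRegionDataΔ.bp, OddConeRegionDataΔ.bpRow, hKdef, numPieces]
    have hn1' : K - 1 + 1 = K := Nat.sub_add_cancel hK
    obtain ⟨k, hk, hk1, hk2⟩ := exists_mem_gridCell (fun k : ℕ => ((d.bp B j k : ℚ) : ℝ)) (K - 1)
      (Δ := E - d.ccQ) (by show ((d.bp B j 0 : ℚ) : ℝ) ≤ E - d.ccQ; rw [e0]; push_cast; linarith [hmE2])
      (by show E - d.ccQ ≤ ((d.bp B j (K - 1 + 1) : ℚ) : ℝ); rw [hn1', eK]; push_cast; linarith)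
    have hkK : k < K := by omega
    have hpiece := hpc j k hjJ hkK
    have hpiece' : d.pieceRowOKP (L.getD j OddConeRegionDataΔ.noLit5) (B.getD j []) j k = true := hpiece
    simp only [OddConeRegionDataΔ.pieceRowOKP, Bool.or_eq_true, decide_eq_true_eq] at hpiece'
    rcases hpiece' with hvac | hpos
    · exfalso
      have hmE : ((max d.E0 (j : ℚ) : ℚ) : ℝ) ≤ E := by push_cast; exact hmE2
      have : ((d.E1 : ℚ) : ℝ) < ((max d.E0 (j : ℚ) : ℚ) : ℝ) := by exact_mod_cast hvac
      linarith
    -- the breakpoints of this piece are `d.bp B j k`, `d.bp B j (k+1)` (definitionally `bpRow` on `B[j]`)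
    have hk1' : ((d.bpRow (B.getD j []) j k : ℚ) : ℝ) ≤ E - d.ccQ := hk1
    have hk2' : E - d.ccQ ≤ ((d.bpRow (B.getD j []) j (k + 1) : ℚ) : ℝ) := hk2
    -- scalar memberships
    have cM : ∀ ε : ℤ, MI.mem d.S ((1 / 2 : ℝ) ^ (p.1 + p.2) * ((-ε : ℤ) : ℝ)) (MI.mulInt d.K1 (-ε)) :=
      fun ε => MI.mem_mulInt hK1 (-ε)
    have cR3 : ∀ ε : ℤ, MI.mem d.S ((1 / 2 : ℝ) ^ (p.2 - p.1) * ((-(ε : ℚ) * (d.κ₀Q / 2) : ℚ) : ℝ))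
        (smulRatMI d.K2 (-(ε : ℚ) * (d.κ₀Q / 2))) := fun ε => mem_smulRatMI hK2 _
    have cRt : MI.mem d.S ((1 / 2 : ℝ) ^ (-(2 * p.2)) * ((-(d.κ₀Q⁻¹ / 2) : ℚ) : ℝ)) (smulRatMI d.K3 (-(d.κ₀Q⁻¹ / 2))) :=
      mem_smulRatMI hK3 _
    -- the inner bisection locates the leaf and applies the four affine tests there
    obtain ⟨vM1, vM2, vR1, vR2⟩ := posOnOddP_sound hS hWb hWσ hWt m3 m4 m5 mψ0 mψt cM cR3 cRt le_rfl le_rfl hpos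
      hk1' hk2' hδb hδσ hδt
    -- back to q-sums
    simp only [val3] at vM1 vM2 vR1 vR2
    rw [← e3, ← eψ0] at vM1 vM2
    rw [← e3, ← e4, ← e5, ← eψt] at vR1 vR2
    push_cast at vM1 vM2 vR1 vR2
    have hκ₁ : 0 ≤ (1 / 2 : ℝ) ^ (p.1 + p.2) := (Real.rpow_pos_of_pos (by norm_num) _).le
    have hκ₂ : 0 ≤ (1 / 2 : ℝ) ^ (p.2 - p.1) := (Real.rpow_pos_of_pos (by norm_num) _).le
    have hκ₀R : (0 : ℝ) < (d.κ₀Q : ℝ) := by exact_mod_cast hκ₀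
    refine oddConeAt_half_of_qCone _ _ _ _ _ p.1 p.2 E j hj ?_ ?_
    · rw [← abs_of_nonneg hκ₁, ← abs_mul, abs_le]
      constructor <;> linarith
    · have hc : 0 ≤ (d.κ₀Q : ℝ) / 2 * (1 / 2 : ℝ) ^ (p.2 - p.1) := by positivity
      rcases le_total 0 (qSum (fun ab => (d.cQ 2 ab : ℝ)) d.l.toFinset ((p.1 + p.2) / 2) (-1) E j) with h3 | h3
      · rw [abs_of_nonneg h3]; linarith
      · rw [abs_of_nonpos h3]
        have := mul_nonneg hc (neg_nonneg.mpr h3)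
        linarith

/-! ### `TaylorTable` glue and the all-cheap literal-table capstone -/

namespace TaylorTable

variable (T : TaylorTable)

/-- **The table's odd cone over its whole box from the literal-table Booleans, cheap pieces.** [folklore] -/
theorem oddCone_of_splitΔLP (π : OddConeParamsΔ) (LP LT : IPoly2x5) (TT : ITab3x5) (L : List OddLit)
    (B : List (List ℚ)) (hl : (T.oddDataΔ π).l.Nodup) (hlψ : (T.oddDataΔ π).lψ.Nodup)
    (ha : (T.oddDataΔ π).toCertH.atomsOK = true) (hs : (T.oddDataΔ π).sizesOK = true)
    (hprm : (T.oddDataΔ π).tailPrmOK = true) (hlen : (T.oddDataΔ π).tailLenOK LT = true)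
    (hPD : ∀ c : ℕ, c < 5 → (T.oddDataΔ π).pdLitOK LP c = true)
    (hmom : ∀ c r : ℕ, c < 5 → r < (T.oddDataΔ π).R → (T.oddDataΔ π).momRowLitOK LP LT c r = true)
    (hcell : ∀ leg k : ℕ, leg < 4 → k < ((T.oddDataΔ π).legPrm leg).nθ → (T.oddDataΔ π).tailCellOK LT leg k = true)
    (hT : ∀ c m : ℕ, c < 5 → m < 3 → (T.oddDataΔ π).tabOKc TT c m = true)
    (hr : ∀ j : ℕ, j < (T.oddDataΔ π).J1 + 1 → (T.oddDataΔ π).rowLitOKL TT L j = true)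
    (hp : ∀ j k : ℕ, j < (T.oddDataΔ π).J1 + 1 → k < numPieces B j → (T.oddDataΔ π).pieceOKBP L B j k = true) :
    T.OddCone :=
  Summit.CriticalPhenomena.Ising3D.oddCone_of_splitΔLP (T.oddDataΔ π) LP LT TT L B hl hlψ ha hs hprm hlen hPD hmom
    hcell hT hr hp

/-- **ALL-CHEAP LITERAL-TABLE CAPSTONE**: table check, enclosure check, the even literal-table Booleans with cheap
pieces (`pieceOKBP`, `…ΔLP`) and the odd literal-table Booleans with cheap pieces (`pieceOKBP`) ⇒ the box is
excluded. Every hypothesis after `he` is ONE small `decide` declaration of a certificate file. [folklore] -/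
theorem boxExcluded_of_taylorTable_dec_of_splitΔLPP (h : T.check = true) (he : T.checkEncl = true)
    (πE : EvenRegionParamsΔ) (LPE LTE : IPoly2 × IPoly2 × IPoly2 × IPoly2) (TTE : ITab3 × ITab3 × ITab3 × ITab3)
    (LE : List (ITriple × ITriple × ITriple)) (BE : List (List ℚ)) (hlE : (T.evenDataΔ πE).l.Nodup)
    (hsE : (T.evenDataΔ πE).sizesOK = true) (hnX : 0 < (T.evenDataΔ πE).prmX.nθ) (hnY : 0 < (T.evenDataΔ πE).prmY.nθ)
    (hlenE : (T.evenDataΔ πE).tailLenOK LTE = true) (hPDE : ∀ c : ℕ, c < 4 → (T.evenDataΔ πE).pdLitOK LPE c = true)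
    (hmomE : ∀ c r : ℕ, c < 4 → r < (T.evenDataΔ πE).R → (T.evenDataΔ πE).momRowLitOK LPE LTE c r = true)
    (hX : ∀ k : ℕ, k < (T.evenDataΔ πE).prmX.nθ → (T.evenDataΔ πE).tailXCellOKL LTE k = true)
    (hY : ∀ k : ℕ, k < (T.evenDataΔ πE).prmY.nθ → (T.evenDataΔ πE).tailYCellOKL LTE k = true)
    (hD : ∀ k : ℕ, k < (T.evenDataΔ πE).prmD.nθ →
      (T.evenDataΔ πE).toH.tailDCellOKL (EvenRegionDataΔ.tailLT LTE) k = true)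
    (hTE : ∀ c m : ℕ, c < 4 → m < 3 → (T.evenDataΔ πE).tabOKc TTE c m = true)
    (hrE : ∀ j : ℕ, j < (T.evenDataΔ πE).J1 + 1 → (T.evenDataΔ πE).rowLitOKL TTE LE j = true)
    (hpE : ∀ j k : ℕ, j < (T.evenDataΔ πE).J1 + 1 → k < numPieces BE j → (T.evenDataΔ πE).pieceOKBP LE BE j k = true)
    (πO : OddConeParamsΔ) (LPO LTO : IPoly2x5) (TTO : ITab3x5) (LO : List OddLit) (BO : List (List ℚ))
    (hlO : (T.oddDataΔ πO).l.Nodup) (hlψ : (T.oddDataΔ πO).lψ.Nodup) (haO : (T.oddDataΔ πO).toCertH.atomsOK = true)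
    (hsO : (T.oddDataΔ πO).sizesOK = true) (hprmO : (T.oddDataΔ πO).tailPrmOK = true)
    (hlenO : (T.oddDataΔ πO).tailLenOK LTO = true) (hPDO : ∀ c : ℕ, c < 5 → (T.oddDataΔ πO).pdLitOK LPO c = true)
    (hmomO : ∀ c r : ℕ, c < 5 → r < (T.oddDataΔ πO).R → (T.oddDataΔ πO).momRowLitOK LPO LTO c r = true)
    (hcellO : ∀ leg k : ℕ, leg < 4 → k < ((T.oddDataΔ πO).legPrm leg).nθ → (T.oddDataΔ πO).tailCellOK LTO leg k = true)
    (hTO : ∀ c m : ℕ, c < 5 → m < 3 → (T.oddDataΔ πO).tabOKc TTO c m = true)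
    (hrO : ∀ j : ℕ, j < (T.oddDataΔ πO).J1 + 1 → (T.oddDataΔ πO).rowLitOKL TTO LO j = true)
    (hpO : ∀ j k : ℕ, j < (T.oddDataΔ πO).J1 + 1 → k < numPieces BO j → (T.oddDataΔ πO).pieceOKBP LO BO j k = true) :
    BoxExcluded T.box :=
  T.boxExcluded_of_taylorTable_dec h he
    (T.evenRegion_of_splitΔLP πE LPE LTE TTE LE BE hlE hsE hnX hnY hlenE hPDE hmomE hX hY hD hTE hrE hpE)
    (T.oddCone_of_splitΔLP πO LPO LTO TTO LO BO hlO hlψ haO hsO hprmO hlenO hPDO hmomO hcellO hTO hrO hpO)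

end TaylorTable

end Summit.CriticalPhenomena.Ising3D
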